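import Summits.HodgeConjecture.HodgeConjecture.Theorems.F0P6aLineSpecialisation
import Literature.AlgebraicGeometry.GroupSchemes.AdmissibleIdealClosureSubscheme
import Literature.AlgebraicGeometry.GroupSchemes.EtaleHopfIdealsOfPoints
import Literature.AlgebraicGeometry.GroupSchemes.CanonicalSubgroupOfPoints
import Literature.AlgebraicGeometry.GroupSchemes.HopfIdealTransportFactor
import Literature.AlgebraicGeometry.AbelianSchemes.AbelianSchemeHomReductionModelFibres
import Literature.AlgebraicGeometry.AbelianSchemes.AbelianSchemeBaseChangeComp
import Literature.AlgebraicGeometry.AbelianSchemes.AbelianSchemeFibreFrobeniusTwist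
import Literature.AlgebraicGeometry.AbelianSchemes.RoofReturnHomThroughCover
import Literature.AlgebraicGeometry.AbelianSchemes.RoofLegsIsogenyOfPolarization
import Literature.AlgebraicGeometry.AbelianSchemes.PolarizationUnitHypothesis
import HarnessLib
import HarnessLib.Audit.LibrarySuggestionsDenyListCruxes

/-!
# `F0P6aKillEngineKillEngine` — ★ RE-HOME of the crux workfile `Lines/F0_P6a_KillEngine.lean` (tree sha16 0f1eef433cafb2e3, 614 l., 18 declaration commands, code-`sorry`-free), PART 1 of 2

This `Theorems/` module is the TREE BYTES of that workfile with the NAMESPACE KEPT, so every fully-qualified name is UNCHANGED; only this module docstring is re-headed,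
the `Lines` imports are switched to their ★ re-homed twins — `Lines.F0_P6a_LineSpecialisation` → ★ `Theorems.F0P6aLineSpecialisation` — and the audit carrier `LibrarySuggestionsDenyListCruxes` is CARRIED on this root part (bare import, LEAD «M-142d» (1) rule «P-κ»; parts 2…n inherit it transitively)
Why a re-home: a `Theorems/` file cannot import a `Lines/` workfile (F0P6-ref1 o-6), and closing stmt-HodgeConjecture-24832 `--as proved --by <Theorems decl>` at rung 0 needs the
sorry-free `Lines` chain behind the gate (RE-HOME TABLE v1.7, LA7-plan (g7); PLAN «L3 cone RE-HOME» v1, LA3-plan (g5); LEAD F0P6-plan (g5) «M-140» (1)∕(4), 2026-09-02).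
SIZE LINT (`Theorems/` files with proofs ≤ 400 l.): the workfile is cut into 2 consecutive parts `F0P6aKillEngineKillEngine` → `F0P6aKillEngine`; this is PART 1 (tree lines :1–:349); each later part imports the previous one and re-opens the scopes open at its cut with their `variable`∕`open`∕`set_option` lines replayed verbatim; the LAST part `F0P6aKillEngine` is the module the `Lines/` shim and consumers import.
After the chain is ★ the `Lines` workfile becomes a one-import SHIM of `F0P6aKillEngine` (a `Lines/` write, batched per cone on the LEAD՚s word), so no environment holds two copies (NO-CROSS-IMPORT).
It asserts nothing beyond what the workfile already proves.  HC_CM is proved only modulo the 7 printed citations (2 remaining: hLiu418 = stmt-HodgeConjecture-24832, h413 = stmt-HodgeConjecture-24833) until rung 0 closes; a re-home is count-neutral.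

## Original module docstring (verbatim)
# LS LEAFLET — (H-1f) THE §1f KILL ENGINE AT ≤ 400 000 HEARTBEATS (HOME lemma file, LA1-p02 (g3), for LA1-p01 (g3)'s (ρ1𝒞) §B (KILL) by copy)

HOME-first lemma file (LA2-plan (g2) 2026-09-02T07:41:43Z (2)–(4) «salvage∕split∕re-target» + 08:31:02Z (3) «GO»); namespace
`Summit.HodgeConjecture.HodgeConjecture.Cruxes.HLiu418.F0P6aLineSpecialisation`; imports the SERVED LS leaflet ED. 2 + ★ only; no filing, no tree write
(the bytes go into LA1-p01 (g3)'s (ρ1𝒞) § of LS ED. 4 by copy).  Every declaration elaborates at ≤ 400 000 heartbeats.  HC_CM is proved only modulo the 7 printed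
citations (2 remaining: hLiu418 = stmt-HodgeConjecture-24832, h413 = stmt-HodgeConjecture-24833) until rung 0 closes.

THE ENGINE (split of LA1-p02 (g2) `LineSpecialisation.reducedRoof.v2` 5e290d36 §1f; the two 1 600 000-heartbeat decls `exists_modelRedHom` ∕ `exists_redHom_spGeoOf_kills`
are decomposed into the lemmas below):
* §1 `quotIncl_eLOf_comp_eq_one` (5e290d36 :1741 verbatim) — the GENERIC UPSTAIRS KILL: `V(eL L) ↪ layerΩ ↪ (famOf)_η —σΩ⁻¹→ A_y —q→ B` is trivial for the roof leg `q`;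
* §1′ `pullback_map_closure_comp_eq_one` — the same kill read on the generic fibre of the FLAT CLOSURE `V(J^sat) ↪ layerR ↪ famOf` (★ p849577);
* §2 `quotIncl_spGeoOf_comp_eq_one_of_pullback_map` — the SPECIAL HALF, ★ p849812-free: a morphism `ψ` out of `A_{red₀ y}` such that `σκ⁻¹ ≫ ψ` kills the special fibre
  of the closure kills `V(spGeoOf y L) ↪ G₀ ↪ A_{red₀ y}` (★ p849577 out-conversion, the dock identification `ε`, comap transport);
* §3 `comp_threePiece_inv_comp_eq_one_of_eq` — BASE-POINT TRANSPORT of a special kill printed through ★ (d5)'s three-piece isomorphism: the special base point of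
  ★ (ν8R)∕★ `RoofLegsSpecialFibreKernelRows` is `s̄_R := c⁻¹ ≫ Spec (residue R)`, the leaflet's is `sκ w := Spec (algebraMap R κ̄)`; they agree by `specMap_toGeomκ_eq`
  (propositionally), and `fibreCongrPtIso` is an `eqToIso`, so a kill at one base point is a kill at the other (`subst`);
* §4 HEAD-K `quotIncl_spGeoOf_comp_eq_one_of_kerRow` — §B (KILL) FOR THE REDUCED LEG `q̄` OF ★ `exists_roofLeg_specialFibre_of_downstairsDual_kerRows` ((b′) of LA1-p01's
  v2 dd38f771): from its (K3-gen) row (TEXT VERBATIM, target generalised to any monoid object `M`), the roof's (r1) and the `LineOf` reading `hK`, PROVIDED the leaflet's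
  CHOSEN presentation isomorphisms are the three-piece ones — hypotheses `hσΩ`, `hσκ`, discharged by `rfl`∕`isoGenericOf_inv`∕`isoSpecialOf_inv` once LA2-p02 (g2)'s (F1)
  def-body swap is in the leaflet (with ED. 2's `.choose` bodies they are NOT provable: the two presentations differ by an `𝒪`-equivariant automorphism of `A_y` that
  need not fix the roof kernel `K`, so (F1) is load-bearing for (KILL), not hygiene only);
* §5 `exists_modelRedHom_of_generic` — the ★ p849812 application HOISTED, with the target family `𝒞` and the generic homomorphism `v` as binders (the 𝒞-retarget of
  LA2-plan (2)), + the two 5e290d36 heads re-proved through §1′∕§2∕§5 (BANKED road, kept for the record).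
-/

set_option autoImplicit false
set_option linter.dupNamespace false

noncomputable section

namespace Summit.HodgeConjecture.HodgeConjecture.Cruxes.HLiu418.F0P6aLineSpecialisation

open CategoryTheory CategoryTheory.Limits NumberField IsDedekindDomain MulAction AlgebraicGeometry
open scoped Matrix Polynomial Pointwise MonoidalCategory
open Literature.NumberTheory.GaloisRepresentations
open Literature.NumberTheory.Automorphic Literature.NumberTheory.Automorphic.UnitaryGroup
open Literature.AlgebraicGeometry.ShimuraVarieties.UnitaryCanonicalModel
open Literature.NumberTheory.Automorphic.Liu2021.AppendixC
open Literature.AlgebraicGeometry.Motives (AlgPoints IntegralModel SchemeOver thickening thickeningGalAction thickeningLift specOver extendPoint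
  specValuationSubring specFractionFieldι specRingHomι)
open Literature.NumberTheory.DiophantineGeometry (geomResidueField specialFibreFunctor specResidueField geomClosedPointIsoSpecResidueField
  geomResidueFieldEquiv toClosureValuationSubring)
open Literature.AlgebraicGeometry.RelativeSpec (ActionOver)
open Literature.NumberTheory.EllipticCurves (genericFibre specGenericPoint)
open Literature.AlgebraicGeometry.AbelianSchemes Literature.AlgebraicGeometry.AbelianSchemes.AbelianSchemeOver
open Literature.AlgebraicGeometry.GroupSchemes.AffineGroupScheme (Alg)
open Summit.HodgeConjecture.HodgeConjecture.Cruxes.HLiu418.F0P6aModuliDatumDefs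
open Summit.HodgeConjecture.HodgeConjecture.Cruxes.HLiu418.F0P6aRGDAssembly
open Summit.HodgeConjecture.HodgeConjecture.Cruxes.HLiu418.F0P6aDatumOfInputs

/-! ### §3 (generic, stated first) Base-point transport of a kill printed through the three-piece isomorphism -/

section Transport

universe u

open scoped MonObj CategoryTheory.Obj

/-- **BASE-POINT TRANSPORT OF A SPECIAL KILL.**  `𝒜 → T` an abelian scheme, `j : U → T`, `x̄ : Spec κ → U`, `x_R : V → T`, and two EQUAL base points `s₁ = s₂ : Spec κ → V`
with `x̄ ≫ j = sᵢ ≫ x_R`; `incl : 𝒦 → 𝒜 ×_T V`.  If `incl_{s₁}` followed by the inverse of ★ (d5)'s three-piece isomorphism `(𝒜|_U)_{x̄} ≅ 𝒜_{x̄ ≫ j} = 𝒜_{s₁ ≫ x_R} ≅ (𝒜_{x_R})_{s₁}`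
and by `q̄` is trivial, then so is the same composite at `s₂` (the middle piece `fibreCongrPtIso` is `eqToIso`: `subst`).  Use: `s₁ = c⁻¹ ≫ Spec (residue R)` (★ (ν8R)),
`s₂ = Spec (algebraMap R κ̄)` (the leaflet's `sκ w`), equal by `specMap_toGeomκ_eq`. [cite: GortzWedhorn2020, Section (4.7) (p. 135) and Prop. 4.16]
[cite: SerreTate1968, §1 Lemma 2] -/
theorem comp_threePiece_inv_comp_eq_one_of_eq {T Us Vr : Scheme.{u}} {κ : Type u} [Field κ]
    (j : Us ⟶ T) (xbar : Spec (.of κ) ⟶ Us) (xR : Vr ⟶ T) (𝒜 : AbelianSchemeOver T)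
    {s₁ s₂ : Spec (.of κ) ⟶ Vr} (h : s₁ = s₂) (hpt₁ : xbar ≫ j = s₁ ≫ xR) (hpt₂ : xbar ≫ j = s₂ ≫ xR)
    {𝒦 : Over Vr} (incl : 𝒦 ⟶ (𝒜.baseChange xR).X) {M : Over (Spec (.of κ))} [MonObj M]
    (qbar : ((𝒜.baseChange j).baseChange xbar).X ⟶ M)
    (h₁ : ((Over.pullback s₁).map incl ≫
        (𝒜.fibreBaseChangeIso j xbar ≪≫ 𝒜.fibreCongrPtIso hpt₁ ≪≫ (𝒜.fibreBaseChangeIso xR s₁).symm).inv.hom.hom.hom) ≫ qbar = 1) :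
    ((Over.pullback s₂).map incl ≫
        (𝒜.fibreBaseChangeIso j xbar ≪≫ 𝒜.fibreCongrPtIso hpt₂ ≪≫ (𝒜.fibreBaseChangeIso xR s₂).symm).inv.hom.hom.hom) ≫ qbar = 1 := by
  subst h
  exact h₁

end Transport

section KillEngine

set_option synthInstance.maxHeartbeats 100000

open Literature.AlgebraicGeometry.GroupSchemes (GroupSchemeKernel.ker GroupSchemeKernel.kerι GroupSchemeKernel.kerLift GroupSchemeKernel.kerLift_ι
  GroupSchemeKernel.kerι_comp GroupSchemeKernel.isClosedImmersion_kerι_left_of_isSeparated)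
open Literature.AlgebraicGeometry.GroupSchemes.AffineGroupScheme (quotIncl ptEquiv spI exists_comp_quotIncl_eq_of_le_ker exists_hom_comp_eq_quotIncl_of_forall
  ptEquiv_quotIncl pullback_map_quotIncl_sat_comp_eq_one quotIncl_spI_comp_eq_one_of_pullback_map flat_specOver_quotient_sat_hom algBaseChangeEquiv)

-- the frame of the D-line՚s `Letters` section VERBATIM
variable {F : Type} [Field F] [NumberField F] [IsCMField F] {ι₁ : F →+* ℂ}
    {Jstar : Matrix (Fin 2) (Fin 2) F}
    {K₀ : C5.OpenCompactSubgroup ↥(finAdelic ↥(maximalRealSubfield F) F (IsCMField.complexConj F) 2 Jstar)}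
    {S : RecordSystemGS F Jstar ι₁ K₀} {hU7ₛ : S.HeckeTranslateDefinedOver}
    {hJ : (Jstar.map (IsCMField.complexConj F))ᵀ = Jstar} {hJu : IsUnit Jstar}
    {Fi : Type} [Field Fi] [Algebra F Fi] {Kc : C5.SmallLevel K₀} {G : Type} [Group G]
    {𝓜 : IntegralModel (𝓞 F) F ((thickening F Fi).obj (S.M.obj Kc))}
    {w : HeightOneSpectrum (𝓞 F)} {hw : (IsCMField.complexConj F) • w ≠ w} {h𝓨 : (𝓜.localise w).IsSmoothProper 1}
    {θ : ActionOver (𝓜.localise w).total.hom ((Fi ≃ₐ[F] Fi) × G)}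
    {e : Fi →ₐ[F] AlgebraicClosure (w.adicCompletion F)}

variable (I : RGDInputsAt F ι₁ Jstar K₀ S hU7ₛ hJ hJu Fi Kc G 𝓜 w hw h𝓨 θ e)

/-! ### §0 the saturation `J^sat ⊂ Γ(layerR I y)` of the line's admissible ideal `J = eL L` and the inclusion of its flat closure into the lifted family -/

/-- **`satOf I y L := J^sat = e_Ω̄(J) ∩ Γ(layerR I y)`**, `J = (eLOf I y L).1` (★ p849577's saturation, spelled out). [cite: EGAIV2, Prop. 2.8.5] -/
abbrev satOf (y : AlgPoints (S.M.obj Kc) (AlgebraicClosure (w.adicCompletion F))) (L : LineOf I y) :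
    haveI := isMonHom_transR I y
    Ideal (Alg (layerR I y)) :=
  haveI := isMonHom_transR I y
  haveI := isAffine_layerR_left I y
  haveI := isAffine_layerΩ_left I y
  ((eLOf I y L).1.map (algBaseChangeEquiv (AlgebraicClosure (w.adicCompletion F)) (layerR I y))).comap
    (Algebra.TensorProduct.includeRight : Alg (layerR I y) →ₐ[↥(closureValuationSubring (w.adicCompletion F))]
      TensorProduct ↥(closureValuationSubring (w.adicCompletion F)) (AlgebraicClosure (w.adicCompletion F)) (Alg (layerR I y)))

/-- **`closureInclOf I y L : V(J^sat) ⟶ famOf I y`** — the flat closure of `V(eL L)` in `layerR I y`, followed by `ιR` (★ p849577 `quotIncl … J^sat ≫ kerι`).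
[cite: EGAIV2, Prop. 2.8.5] [cite: GortzWedhorn2020, Definition 4.45 (2), p. 117] -/
abbrev closureInclOf (y : AlgPoints (S.M.obj Kc) (AlgebraicClosure (w.adicCompletion F))) (L : LineOf I y) :
    haveI := isMonHom_transR I y
    haveI := isAffine_layerR_left I y
    specOver ↥(closureValuationSubring (w.adicCompletion F)) (Alg (layerR I y) ⧸ satOf I y L) ⟶ (famOf I y).X :=
  haveI := isMonHom_transR I y
  haveI := isAffine_layerR_left I y
  quotIncl (layerR I y) (satOf I y L) ≫ ιR I y

/-- `V(J^sat) → Spec R` is FLAT (★ p849577 `flat_specOver_quotient_sat_hom`: `R = 𝒪_Ω̄` is a valuation ring, Bezout). [cite: EGAIV2, Prop. 2.8.5]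
[cite: StacksProject, Tag 0539] -/
theorem flat_closure_hom (y : AlgPoints (S.M.obj Kc) (AlgebraicClosure (w.adicCompletion F))) (L : LineOf I y) :
    haveI := isMonHom_transR I y
    haveI := isAffine_layerR_left I y
    Flat (specOver ↥(closureValuationSubring (w.adicCompletion F)) (Alg (layerR I y) ⧸ satOf I y L)).hom := by
  haveI := isMonHom_transR I y
  haveI := isAffine_layerR_left I y
  haveI := isAffine_layerΩ_left I y
  exact flat_specOver_quotient_sat_hom (AlgebraicClosure (w.adicCompletion F)) (layerR I y) (eLOf I y L).1

/-! ### §1 THE GENERIC UPSTAIRS KILL (5e290d36 :1741 verbatim) -/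

set_option maxHeartbeats 400000 in
open scoped MonObj in
set_option backward.isDefEq.respectTransparency false in
/-- **THE GENERIC KILL**: `V(eL L) ↪ layerΩ I y → A_y —q→ B` is trivial as soon as `q` kills the points of `L` — `layerΩ I y` is finite étale over `Ω̄ = Ω̄^{alg}` (§1c-0), so the
ideal `eL L` is the ideal of its points (★ `EtaleIdealPoints.eq_ker_pi_ptEquiv_points`), each of which lies on `L` by the membership law `eLOf_le_ker_iff`, hence in `Ker q` ((r1)
with `L ⊆ K`); ★ `exists_hom_comp_eq_quotIncl_of_forall` through the closed subscheme `Ker q′ ↪ layerΩ I y` (`q′ := (ιR)_Ω̄ ≫ (σ3)⁻¹ ≫ q`). [cite: Tate1997FiniteFlatGroupSchemes, (3.7)]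
[cite: StacksProject, Tag 00U3] [cite: Liu2021, Prop. D.8 (2) p. 135] -/
theorem quotIncl_eLOf_comp_eq_one (y : AlgPoints (S.M.obj Kc) (AlgebraicClosure (w.adicCompletion F))) (L : LineOf I y)
    {B : AbelianSchemeOver (Spec (.of (AlgebraicClosure (w.adicCompletion F))))} (q : (schΩOf S Kc 𝓜 w e I.univ y).X ⟶ B.X) [IsMonHom q]
    (K : Subgroup ((fibreΩOf S Kc 𝓜 w e I.univ y).Points (AlgebraicClosure (w.adicCompletion F))))
    (hK : ∀ P, P ∈ L.1 ↔ P ∈ K ∧ IsIdealTorsionΩ S Kc 𝓜 w e I.univ I.act y ((IsCMField.complexConj F) • w).asIdeal P)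
    (r1 : ∀ P : (fibreΩOf S Kc 𝓜 w e I.univ y).Points (AlgebraicClosure (w.adicCompletion F)),
      (AlgPoints.map q P : B.toAffine.toAbelianVariety.Points (AlgebraicClosure (w.adicCompletion F))) = 1 ↔ P ∈ K) :
    haveI := isMonHom_transR I y
    haveI := isAffine_layerΩ_left I y
    quotIncl (layerΩ I y) (eLOf I y L).1 ≫ ((Over.pullback (sΩ w)).map (ιR I y) ≫ (isoGenericOf I y).inv ≫ q) = 1 := by
  haveI := isMonHom_transR I y
  haveI := isAffine_layerΩ_left I y
  haveI := etale_layerΩ_hom I y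
  haveI := B.isProper
  haveI : IsClosedImmersion (GroupSchemeKernel.kerι ((Over.pullback (sΩ w)).map (ιR I y) ≫ (isoGenericOf I y).inv ≫ q)).left :=
    GroupSchemeKernel.isClosedImmersion_kerι_left_of_isSeparated _
  haveI : IsAffine (GroupSchemeKernel.ker ((Over.pullback (sΩ w)).map (ιR I y) ≫ (isoGenericOf I y).inv ≫ q)).left :=
    isAffine_of_isAffineHom (GroupSchemeKernel.kerι ((Over.pullback (sΩ w)).map (ιR I y) ≫ (isoGenericOf I y).inv ≫ q)).left
  -- every point of `V(eL L)` lies in `Ker q′`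
  have hu : ∀ i : {x : specOver (AlgebraicClosure (w.adicCompletion F)) (AlgebraicClosure (w.adicCompletion F)) ⟶ layerΩ I y //
        (eLOf I y L).1 ≤ RingHom.ker (ptEquiv (layerΩ I y) (AlgebraicClosure (w.adicCompletion F)) x).toRingHom},
      ∃ v : specOver (AlgebraicClosure (w.adicCompletion F)) (AlgebraicClosure (w.adicCompletion F)) ⟶
          GroupSchemeKernel.ker ((Over.pullback (sΩ w)).map (ιR I y) ≫ (isoGenericOf I y).inv ≫ q),
        v ≫ GroupSchemeKernel.kerι ((Over.pullback (sΩ w)).map (ιR I y) ≫ (isoGenericOf I y).inv ≫ q) = i.1 := by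
    intro i
    have hmem := (eLOf_le_ker_iff I y L i.1).1 i.2
    have hq1 : i.1 ≫ ((Over.pullback (sΩ w)).map (ιR I y) ≫ (isoGenericOf I y).inv ≫ q) = 1 := by
      have h := (r1 _).2 ((hK _).1 hmem).1
      simpa only [AlgPoints.map, Category.assoc] using h
    exact ⟨GroupSchemeKernel.kerLift i.1 hq1, GroupSchemeKernel.kerLift_ι _ _⟩
  obtain ⟨vv, hvv, -⟩ := exists_hom_comp_eq_quotIncl_of_forall
    (GroupSchemeKernel.kerι ((Over.pullback (sΩ w)).map (ιR I y) ≫ (isoGenericOf I y).inv ≫ q))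
    (fun i : {x : specOver (AlgebraicClosure (w.adicCompletion F)) (AlgebraicClosure (w.adicCompletion F)) ⟶ layerΩ I y //
        (eLOf I y L).1 ≤ RingHom.ker (ptEquiv (layerΩ I y) (AlgebraicClosure (w.adicCompletion F)) x).toRingHom} => i.1) hu
  -- `eL L` IS the points ideal (étale), so `V(eL L)` factors through the points subscheme
  have hJ := Literature.AlgebraicGeometry.GroupSchemes.EtaleIdealPoints.eq_ker_pi_ptEquiv_points (layerΩ I y) (eLOf I y L).1
  obtain ⟨z, hz⟩ := exists_comp_quotIncl_eq_of_le_ker (layerΩ I y)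
    (RingHom.ker (AlgHom.pi fun i : {x : specOver (AlgebraicClosure (w.adicCompletion F)) (AlgebraicClosure (w.adicCompletion F)) ⟶ layerΩ I y //
        (eLOf I y L).1 ≤ RingHom.ker (ptEquiv (layerΩ I y) (AlgebraicClosure (w.adicCompletion F)) x).toRingHom} =>
          ptEquiv (layerΩ I y) (AlgebraicClosure (w.adicCompletion F)) i.1).toRingHom)
    (quotIncl (layerΩ I y) (eLOf I y L).1) (by
      rw [ptEquiv_quotIncl]
      intro a ha
      rw [RingHom.mem_ker, AlgHom.toRingHom_eq_coe, AlgHom.coe_toRingHom, Ideal.Quotient.mkₐ_eq_mk, Ideal.Quotient.eq_zero_iff_mem]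
      rw [hJ]
      exact ha)
  rw [← hz, Category.assoc, ← hvv, Category.assoc, GroupSchemeKernel.kerι_comp, MonObj.comp_one, MonObj.comp_one]

/-! ### §1′ the generic kill read on the generic fibre of the flat closure `V(J^sat)` -/

set_option maxHeartbeats 400000 in
open scoped MonObj in
set_option backward.isDefEq.respectTransparency false in
/-- **THE GENERIC KILL ON THE CLOSURE** (MODEL currency): `V(J^sat)_η ↪ (layerR)_η ↪ (famOf I y)_η —σΩ⁻¹→ A_y —q→ B` is trivial for the roof leg `q` (§1 moved to the closure by
★ p849577 `pullback_map_quotIncl_sat_comp_eq_one`).  This is the generic-kill PREMISS of ★ (ν8R-model) (v-b) ∕ ★ p849812 (v-b) ∕ the (K3-gen) row, modulo the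
presentation `σΩ = isoGenericOf I y`. [cite: EGAIV2, Prop. 2.8.5] [cite: Liu2021, Prop. D.8 (2) p. 135] -/
theorem pullback_map_closure_comp_eq_one (y : AlgPoints (S.M.obj Kc) (AlgebraicClosure (w.adicCompletion F))) (L : LineOf I y)
    {B : AbelianSchemeOver (Spec (.of (AlgebraicClosure (w.adicCompletion F))))} (q : (schΩOf S Kc 𝓜 w e I.univ y).X ⟶ B.X) [IsMonHom q]
    (K : Subgroup ((fibreΩOf S Kc 𝓜 w e I.univ y).Points (AlgebraicClosure (w.adicCompletion F))))
    (hK : ∀ P, P ∈ L.1 ↔ P ∈ K ∧ IsIdealTorsionΩ S Kc 𝓜 w e I.univ I.act y ((IsCMField.complexConj F) • w).asIdeal P)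
    (r1 : ∀ P : (fibreΩOf S Kc 𝓜 w e I.univ y).Points (AlgebraicClosure (w.adicCompletion F)),
      (AlgPoints.map q P : B.toAffine.toAbelianVariety.Points (AlgebraicClosure (w.adicCompletion F))) = 1 ↔ P ∈ K) :
    haveI := isMonHom_transR I y
    haveI := isAffine_layerR_left I y
    (Over.pullback (sΩ w)).map (closureInclOf I y L) ≫ (isoGenericOf I y).inv ≫ q = 1 := by
  haveI := isMonHom_transR I y
  haveI := isAffine_layerR_left I y
  haveI := isAffine_layerΩ_left I y
  have hcore := quotIncl_eLOf_comp_eq_one I y L q K hK r1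
  have hgen := pullback_map_quotIncl_sat_comp_eq_one (AlgebraicClosure (w.adicCompletion F)) (layerR I y) (eLOf I y L).1 (eLOf I y L).2.1 _ hcore
  rw [Functor.map_comp, Category.assoc]
  exact hgen

/-! ### §2 THE SPECIAL HALF (★ p849812-free): a kill of the special fibre of the closure is a kill of `V(spGeoOf y L) ↪ G₀ ↪ A_{red₀ y}` -/

open scoped MonObj in
/-- **KILLS TRANSPORT ALONG AN ISOMORPHISM OF AFFINE SCHEMES** (5e290d36 :1866 verbatim): if `V(I) ↪ G —φ→ G′ —g→ M` is trivial then so is `V(Γ(φ)⁻¹ I) ↪ G′ —g→ M`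
(`φ` an iso; ★ `AdmIdealTransport.quotIncl_comp_eq_one_of_comap` at `φ⁻¹` and ★ `comap_appTop_inv_comap_appTop_hom`). [cite: GortzWedhorn2023, (27.1.1) and §(27.2) (p. 607)]
[cite: Waterhouse1979, §2.1] -/
theorem quotIncl_comap_comp_eq_one_of_iso {R : Type} [CommRing R] {G₁ G₂ M : SchemeOver R} [IsAffine G₁.left] [IsAffine G₂.left] [MonObj M]
    (φ : G₁ ≅ G₂) (J : Ideal (Alg G₁)) (g : G₂ ⟶ M) (h : quotIncl G₁ J ≫ φ.hom ≫ g = 1) :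
    quotIncl G₂ (J.comap φ.hom.left.appTop.hom : Ideal (Alg G₂)) ≫ g = 1 := by
  have key : ∀ J' : Ideal (Alg G₁), J' = J → quotIncl G₁ J' ≫ φ.hom ≫ g = 1 := by
    rintro J' rfl; exact h
  have h1 := key _ (Literature.AlgebraicGeometry.GroupSchemes.AdmIdealTransport.comap_appTop_inv_comap_appTop_hom φ J)
  have h2 := Literature.AlgebraicGeometry.GroupSchemes.AdmIdealTransport.quotIncl_comp_eq_one_of_comap φ.inv
    (J.comap φ.hom.left.appTop.hom : Ideal (Alg G₂)) (φ.hom ≫ g) h1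
  simpa only [Iso.inv_hom_id_assoc] using h2

set_option maxHeartbeats 400000 in
open scoped MonObj CategoryTheory.Obj in
set_option backward.isDefEq.respectTransparency false in
/-- **THE SPECIAL HALF OF THE ENGINE** (★ p849812-FREE): for ANY morphism `ψ : A_{red₀ y} → M` into a monoid object over `κ̄(w)`, if
`V(J^sat)_{sκ} ↪ (layerR)_{sκ} ↪ (famOf I y)_{sκ} —σκ⁻¹→ A_{red₀ y} —ψ→ M` is trivial (`σκ = isoSpecialOf I y`), then `ψ` KILLS `V(spGeoOf I 𝔡 y L) ↪ G₀(red₀ y) ↪ A_{red₀ y}`: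
★ p849577 `quotIncl_spI_comp_eq_one_of_pullback_map` (`spIOf = spI … (eL L)` by definition), the dock identification `ε ≫ ι₀G ≫ σκ = (ιR)_{sκ}` (§1b), and
`quotIncl_comap_comp_eq_one_of_iso` along `ε` (`spGeoOf = comap_ε spIOf` by definition). [cite: EGAIV2, Prop. 2.8.5] [cite: Tate1997FiniteFlatGroupSchemes, (3.7)]
[cite: Liu2021, Prop. D.8 (2) p. 135, p. 137] -/
theorem quotIncl_spGeoOf_comp_eq_one_of_pullback_map [ExpChar (geomResidueField w) I.pChar] (𝔡 : ∀ xbar, DockAt I xbar)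
    (y : AlgPoints (S.M.obj Kc) (AlgebraicClosure (w.adicCompletion F))) (L : LineOf I y)
    {M : SchemeOver (geomResidueField w)} [MonObj M]
    (ψ : (sch₀Of 𝓜 w I.univ (red₀Of S Kc 𝓜 w h𝓨 e y)).X ⟶ M)
    (hψ : haveI := isMonHom_transR I y
      haveI := isAffine_layerR_left I y
      (Over.pullback (sκ w)).map (closureInclOf I y L) ≫ (isoSpecialOf I y).inv ≫ ψ = 1) :
    letI := (𝔡 (red₀Of S Kc 𝓜 w h𝓨 e y)).grp₀
    haveI := (𝔡 (red₀Of S Kc 𝓜 w h𝓨 e y)).aff₀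
    quotIncl (𝔡 (red₀Of S Kc 𝓜 w h𝓨 e y)).G₀ (spGeoOf I 𝔡 y L).1 ≫ (𝔡 (red₀Of S Kc 𝓜 w h𝓨 e y)).ι₀G ≫ ψ = 1 := by
  letI := (𝔡 (red₀Of S Kc 𝓜 w h𝓨 e y)).grp₀
  haveI := (𝔡 (red₀Of S Kc 𝓜 w h𝓨 e y)).aff₀
  letI := (toGeomκ w).toAlgebra
  haveI := isMonHom_transR I y
  haveI := isAffine_layerR_left I y
  haveI := isAffine_layerκ_left I y
  haveI := isAffine_layerΩ_left I y
  -- the kill on the special fibre of the closure, moved to `V(spI J) = V(spIOf)` by ★ p849577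
  have h : (Over.pullback (sκ w)).map (quotIncl (layerR I y) (satOf I y L)) ≫
      ((Over.pullback (sκ w)).map (ιR I y) ≫ (isoSpecialOf I y).inv ≫ ψ) = 1 := by
    rw [← Category.assoc, ← Functor.map_comp]
    exact hψ
  have hkill : quotIncl (layerκ I y) (spIOf I y L) ≫ ((Over.pullback (sκ w)).map (ιR I y) ≫ (isoSpecialOf I y).inv ≫ ψ) = 1 :=
    quotIncl_spI_comp_eq_one_of_pullback_map (AlgebraicClosure (w.adicCompletion F)) (geomResidueField w) (layerR I y) (eLOf I y L).1
      (eLOf I y L).2.1 _ h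
  -- `ε ≫ ι₀G ≫ (σ2) = (ιR)_κ̄` (§1b), so `(ιR)_κ̄ ≫ (σ2)⁻¹ ≫ ψ = ε ≫ ι₀G ≫ ψ` (cancellation by `simp only`, reducible keys only)
  have hkill' : quotIncl (layerκ I y) (spIOf I y L) ≫ (εOf I 𝔡 y).hom ≫ ((𝔡 (red₀Of S Kc 𝓜 w h𝓨 e y)).ι₀G ≫ ψ) = 1 := by
    rw [← εOf_hom_comp_ι₀G_comp_isoSpecialOf_hom I 𝔡 y] at hkill
    simpa only [Category.assoc, Iso.hom_inv_id_assoc] using hkill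
  exact quotIncl_comap_comp_eq_one_of_iso (εOf I 𝔡 y) (spIOf I y L) _ hkill'

/-! ### §4 HEAD-K: §B (KILL) for the reduced leg `q̄` of ★ `…_kerRows`, from its (K3-gen) row — under the (F1) identifications of the presentation isomorphisms -/

set_option maxHeartbeats 400000 in
open scoped MonObj CategoryTheory.Obj in
set_option backward.isDefEq.respectTransparency false in
/-- **(ρ1𝒞) §B (KILL) FROM THE (K3-gen) ROW.**  Let `q : A_y → B` be the roof leg of `hroof y L` with kernel reading (r1) on `Ω̄`-points and `K ∩ A_y[𝔭_{c•w}](Ω̄) = L` (`hK`), and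
let `q̄ : A_{red₀ y} → M` be ANY morphism into a monoid object over `κ̄(w)` satisfying the (K3-gen) row of ★ `exists_roofLeg_specialFibre_of_downstairsDual_kerRows`
((b′) of LA1-p01 (g3), TEXT VERBATIM: kill along every flat `𝒦 ↪ 𝒜_x̃`, generic premiss through ★ (d5)'s three-piece isomorphism at `η_R`, special conclusion at
`s̄_R = c⁻¹ ≫ Spec (residue R)`).  ASSUME the leaflet's presentation isomorphisms ARE the three-piece ones (`hσΩ`, `hσκ` — `rfl` after LA2-p02 (g2)'s (F1) def-body
swap; NOT provable for ED. 2's `.choose` bodies).  THEN `q̄` kills `V(spGeoOf I 𝔡 y L) ↪ G₀(red₀ y) ↪ A_{red₀ y}`.  PROOF: §1′ at `𝒦 := V(J^sat)` (flat, §0) is the premiss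
(modulo `hσΩ`; `liftOf = extendPoint …`, `sΩ w = (η_R).left` definitionally); the row gives the kill at `s̄_R`; §3 moves it to `sκ w` (`specMap_toGeomκ_eq`); `hσκ` and §2
finish. [cite: Liu2021, Prop. D.8 (2) p. 135, p. 137] [cite: SerreTate1968, §1 Lemma 2] [cite: EGAIV2, Prop. 2.8.5] [cite: BoschLutkebohmertRaynaud1990, §7.3 Prop. 6 (p. 180)] -/
theorem quotIncl_spGeoOf_comp_eq_one_of_kerRow [ExpChar (geomResidueField w) I.pChar] (𝔡 : ∀ xbar, DockAt I xbar)
    (y : AlgPoints (S.M.obj Kc) (AlgebraicClosure (w.adicCompletion F))) (L : LineOf I y)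
    {B : AbelianSchemeOver (Spec (.of (AlgebraicClosure (w.adicCompletion F))))} (q : (schΩOf S Kc 𝓜 w e I.univ y).X ⟶ B.X) [IsMonHom q]
    (K : Subgroup ((fibreΩOf S Kc 𝓜 w e I.univ y).Points (AlgebraicClosure (w.adicCompletion F))))
    (hK : ∀ P, P ∈ L.1 ↔ P ∈ K ∧ IsIdealTorsionΩ S Kc 𝓜 w e I.univ I.act y ((IsCMField.complexConj F) • w).asIdeal P)
    (r1 : ∀ P : (fibreΩOf S Kc 𝓜 w e I.univ y).Points (AlgebraicClosure (w.adicCompletion F)),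
      (AlgPoints.map q P : B.toAffine.toAbelianVariety.Points (AlgebraicClosure (w.adicCompletion F))) = 1 ↔ P ∈ K)
    {M : SchemeOver (geomResidueField w)} [MonObj M]
    (qbar : (sch₀Of 𝓜 w I.univ (red₀Of S Kc 𝓜 w h𝓨 e y)).X ⟶ M)
    -- (F1) the CHOSEN generic presentation iso IS the three-piece iso at `η_R = sΩ w`
    (hσΩ : (isoGenericOf I y).inv =
      (I.univ.fibreBaseChangeIso ((𝓜.localise w).genericIso'.inv.left ≫ pullback.fst (𝓜.localise w).total.hom (specGenericPoint (HeightOneSpectrum.valuationSubringAtPrime F w) F))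
          (thickeningLift e (S.M.obj Kc) y).left ≪≫
        I.univ.fibreCongrPtIso (left_thickeningLift_comp_genericι_eq S Kc 𝓜 w h𝓨 e y) ≪≫
        (I.univ.fibreBaseChangeIso (liftOf S Kc 𝓜 w h𝓨 e y).left (sΩ w)).symm).inv.hom.hom.hom)
    -- (F1) the CHOSEN special presentation iso IS the three-piece iso at `sκ w`
    (hσκ : (isoSpecialOf I y).inv =
      (I.univ.fibreBaseChangeIso (pullback.fst (𝓜.localise w).total.hom (specResidueField w)) (red₀Of S Kc 𝓜 w h𝓨 e y).left ≪≫
        I.univ.fibreCongrPtIso (left_red₀Of_comp_specialι_eq S Kc 𝓜 w h𝓨 e y) ≪≫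
        (I.univ.fibreBaseChangeIso (liftOf S Kc 𝓜 w h𝓨 e y).left (sκ w)).symm).inv.hom.hom.hom)
    -- the (K3-gen) row of ★ `exists_roofLeg_specialFibre_of_downstairsDual_kerRows` for `q̄` (text of LA1-p01 (g3)'s (b′), target generalised)
    (hK3 : haveI : IsProper (𝓜.localise w).total.hom := h𝓨.2
      ∀ (𝒦 : Over (Spec (.of (closureValuationSubring (w.adicCompletion F))))) (incl : 𝒦 ⟶ (I.univ.baseChange (extendPoint (closureValuationSubring (w.adicCompletion F)) (toClosureValuationSubring w) (𝓜.localise w).total ((𝓜.localise w).modelPointsEquiv.symm (thickeningLift e (S.M.obj Kc) y))).left).X) [Flat 𝒦.hom],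
        ((Over.pullback (specFractionFieldι (closureValuationSubring (w.adicCompletion F)) (toClosureValuationSubring w)).left).map incl ≫
            (I.univ.fibreBaseChangeIso ((𝓜.localise w).genericIso'.inv.left ≫ pullback.fst (𝓜.localise w).total.hom (specGenericPoint (HeightOneSpectrum.valuationSubringAtPrime F w) F)) (thickeningLift e (S.M.obj Kc) y).left ≪≫ I.univ.fibreCongrPtIso ((𝓜.localise w).left_specFractionFieldι_comp_extendPoint_modelPointsEquiv_symm (thickeningLift e (S.M.obj Kc) y)).symm ≪≫ (I.univ.fibreBaseChangeIso (extendPoint (closureValuationSubring (w.adicCompletion F)) (toClosureValuationSubring w) (𝓜.localise w).total ((𝓜.localise w).modelPointsEquiv.symm (thickeningLift e (S.M.obj Kc) y))).left (specFractionFieldι (closureValuationSubring (w.adicCompletion F)) (toClosureValuationSubring w)).left).symm).inv.hom.hom.hom) ≫ q = 1 →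
        ((Over.pullback ((geomClosedPointIsoSpecResidueField w).inv.left ≫ (specRingHomι (closureValuationSubring (w.adicCompletion F)) (toClosureValuationSubring w) (IsLocalRing.residue (closureValuationSubring (w.adicCompletion F)))).left)).map incl ≫
            (I.univ.fibreBaseChangeIso (pullback.fst (𝓜.localise w).total.hom (specResidueField w)) ((𝓜.localise w).geomReductionMap (thickeningLift e (S.M.obj Kc) y)).left ≪≫ I.univ.fibreCongrPtIso (((𝓜.localise w).left_geomReductionMap_comp_fst (thickeningLift e (S.M.obj Kc) y)).trans (Category.assoc _ _ _).symm) ≪≫ (I.univ.fibreBaseChangeIso (extendPoint (closureValuationSubring (w.adicCompletion F)) (toClosureValuationSubring w) (𝓜.localise w).total ((𝓜.localise w).modelPointsEquiv.symm (thickeningLift e (S.M.obj Kc) y))).left ((geomClosedPointIsoSpecResidueField w).inv.left ≫ (specRingHomι (closureValuationSubring (w.adicCompletion F)) (toClosureValuationSubring w) (IsLocalRing.residue (closureValuationSubring (w.adicCompletion F)))).left)).symm).inv.hom.hom.hom) ≫ qbar = 1) :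
    letI := (𝔡 (red₀Of S Kc 𝓜 w h𝓨 e y)).grp₀
    haveI := (𝔡 (red₀Of S Kc 𝓜 w h𝓨 e y)).aff₀
    quotIncl (𝔡 (red₀Of S Kc 𝓜 w h𝓨 e y)).G₀ (spGeoOf I 𝔡 y L).1 ≫ (𝔡 (red₀Of S Kc 𝓜 w h𝓨 e y)).ι₀G ≫ qbar = 1 := by
  letI := (𝔡 (red₀Of S Kc 𝓜 w h𝓨 e y)).grp₀
  haveI := (𝔡 (red₀Of S Kc 𝓜 w h𝓨 e y)).aff₀
  letI := (toGeomκ w).toAlgebra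
  haveI : IsProper (𝓜.localise w).total.hom := h𝓨.2
  haveI := isMonHom_transR I y
  haveI := isAffine_layerR_left I y
  haveI := isAffine_layerΩ_left I y
  -- §1′: the generic kill on the closure, through `σΩ⁻¹`, rewritten through the three-piece iso by `hσΩ`
  have h1 := pullback_map_closure_comp_eq_one I y L q K hK r1
  rw [hσΩ] at h1
  -- the (K3-gen) row at `𝒦 := V(J^sat)` (flat)
  haveI := flat_closure_hom I y L
  have h3 := hK3 (specOver ↥(closureValuationSubring (w.adicCompletion F)) (Alg (layerR I y) ⧸ satOf I y L)) (closureInclOf I y L)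
    (by rw [Category.assoc]; exact h1)
  -- §3: move the special base point `s̄_R ↦ sκ w` (`liftOf = extendPoint …` definitionally)
  have h4 := comp_threePiece_inv_comp_eq_one_of_eq (s₂ := sκ w) (pullback.fst (𝓜.localise w).total.hom (specResidueField w)) (red₀Of S Kc 𝓜 w h𝓨 e y).left
    (liftOf S Kc 𝓜 w h𝓨 e y).left I.univ (specMap_toGeomκ_eq w).symm
    (((𝓜.localise w).left_geomReductionMap_comp_fst (thickeningLift e (S.M.obj Kc) y)).trans (Category.assoc _ _ _).symm)
    (left_red₀Of_comp_specialι_eq S Kc 𝓜 w h𝓨 e y) (closureInclOf I y L) qbar h3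
  -- `hσκ` and §2
  rw [← hσκ, Category.assoc] at h4
  exact quotIncl_spGeoOf_comp_eq_one_of_pullback_map I 𝔡 y L qbar h4


/-! (★ re-home, size lint: PART 1 of 2 ends here at tree line :349; the workfile continues, in the same namespace, in `Theorems/F0P6aKillEngine.lean`.) -/

end KillEngine
end Summit.HodgeConjecture.HodgeConjecture.Cruxes.HLiu418.F0P6aLineSpecialisation
end
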